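import Summits.AtomisticToContinuum.Crystallization.Theorems.FrustratedLawDichotomyStrainedPatchHomLeafBridgeW
import Summits.AtomisticToContinuum.Crystallization.Theorems.FrustratedLawDichotomyStrainedPatchHomLeafCheckC

/-!
# The reflected (P4) fcc GRAM-LEAF CHECKER, v2: window-safe square roots and COMPUTABLE from the start

decomp-a2c hand-2 g21 (crux `AperiodicFrustratedLawGap`, stmt-AtomisticToContinuum-27623).  `…HomLeafCheck` (v1) verbatim except: every square root by
`…TermSqrt.sqrtW` (tight on the whole window `q ≤ 81/4`; the Literature `FI.sqrt` is tight only below `16`), the term checks are the v2 ones of `…TermEvalW`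
(bridge `…LeafBridgeW.boxSum_ge_of_termChecks2`), and the label box is the computable `…LeafCheckC.boxC` (`boxC_eq : boxC = box7`), so `termsOK2 / sumV2 /
sumG2 / sumC2` COMPILE (instrument mode, critic row 799 (b)) AND reduce in the kernel.  ★★★ `leaf_sound2` as before.  0 sorry; standard axioms.
`--supports stmt-AtomisticToContinuum-27623`.
-/

namespace Summit.AtomisticToContinuum.Crystallization.Theorems.FrustratedLawDichotomyStrainedPatchHomLeafCheckW

open scoped BigOperators RealInnerProductSpace
open Set
open Literature.Analysis.ValidatedNumerics.Numerics
open Summit.AtomisticToContinuum.Crystallization.Theorems.ChargedEnergyGapNegative (E3)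
open Summit.AtomisticToContinuum.Crystallization.Theorems.FrustratedLawDichotomySchurCut (effPot w₄₅ ω₄)
open Summit.AtomisticToContinuum.Crystallization.Theorems.FrustratedLawDichotomyStrainedPatchHomSplit (latPt)
open Summit.AtomisticToContinuum.Crystallization.Theorems.FrustratedLawDichotomyStrainedPatchHomTermEval
open Summit.AtomisticToContinuum.Crystallization.Theorems.FrustratedLawDichotomyStrainedPatchHomTermEvalPoint
open Summit.AtomisticToContinuum.Crystallization.Theorems.FrustratedLawDichotomyStrainedPatchHomTermSqrt
open Summit.AtomisticToContinuum.Crystallization.Theorems.FrustratedLawDichotomyStrainedPatchHomTermEvalW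
open Summit.AtomisticToContinuum.Crystallization.Theorems.FrustratedLawDichotomyStrainedPatchHomLeafBridgeW (boxSum_ge_of_termChecks2)
open Summit.AtomisticToContinuum.Crystallization.Theorems.FrustratedLawDichotomyStrainedPatchHomLeafCheck (Lz q0z rz box7)
open Summit.AtomisticToContinuum.Crystallization.Theorems.FrustratedLawDichotomyStrainedPatchHomLeafCheckC (boxC boxC_eq)
open Literature.Barriers.AtomisticToContinuum.FlatleyTheil2015 (fccVec)

/-! ## §2. Hint generators (any value is SOUND — the checks decide; these just aim to pass) -/

/-- Curvature constant generator: the regime expression's upper end (max of the two pieces on a straddle), floored at `0`. -/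
def curvM2 (qlo qhi : ℤ) : ℤ :=
  let A := FI.ofScaled qlo
  let B := FI.ofScaled qhi
  max 0
    (if 25 * qhi ≤ 64 * (SC : ℤ) then (eBump A B (sqrtW A).lo (sqrtW B).hi).hi
    else if 64 * (SC : ℤ) ≤ 25 * qlo then
      (if qhi ≤ 9 * (SC : ℤ) then (eLJ A B).hi
      else if 9 * (SC : ℤ) ≤ qlo then
        (if 4 * qhi ≤ 81 * (SC : ℤ) then (eWin (sqrtW A).lo (sqrtW B).hi).hi
        else if 81 * (SC : ℤ) ≤ 4 * qlo then 0
        else (eWin (sqrtW A).lo (sqrtW (FI.ofFrac 81 4)).hi).hi)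
      else max (eLJ A (FI.ofInt 9)).hi (eWin (sqrtW (FI.ofInt 9)).lo (sqrtW B).hi).hi)
    else max (eBump A (FI.ofFrac 64 25) (sqrtW A).lo (sqrtW (FI.ofFrac 64 25)).hi).hi (eLJ (FI.ofFrac 64 25) B).hi)

/-- Value lower-bound generator (the regime enclosure's lower end). -/
def valLo2 (q0 : ℤ) : ℤ :=
  let Q := FI.ofScaled q0
  if 25 * q0 ≤ 64 * (SC : ℤ) then
    (eBumpE1 Q).lo + min (FI.mul (eBumpC Q) (mulRat (FI.ofScaled (sqrtW Q).lo) 5 4)).lo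
      (FI.mul (eBumpC Q) (mulRat (FI.ofScaled (sqrtW Q).hi) 5 4)).lo
  else if q0 ≤ 9 * (SC : ℤ) then (eVq Q).lo
  else if 4 * q0 ≤ 81 * (SC : ℤ) then (eWinVal Q (sqrtW Q).hi).lo
  else 0

/-- Derivative lower-end generator. -/
def derivLo2 (q0 : ℤ) : ℤ :=
  let Q := FI.ofScaled q0
  if 25 * q0 ≤ 64 * (SC : ℤ) then
    (eBumpE2 Q).lo + min (FI.mul (eBumpC2 Q) (mulRat (FI.ofScaled (sqrtW Q).lo) 5 4)).lo
      (FI.mul (eBumpC2 Q) (mulRat (FI.ofScaled (sqrtW Q).hi) 5 4)).lo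
  else if q0 ≤ 9 * (SC : ℤ) then (eGlj Q).lo
  else if 4 * q0 ≤ 81 * (SC : ℤ) then (eWinDer (sqrtW Q).hi (sqrtW Q).lo).lo
  else 0

/-- Derivative upper-end generator. -/
def derivHi2 (q0 : ℤ) : ℤ :=
  let Q := FI.ofScaled q0
  if 25 * q0 ≤ 64 * (SC : ℤ) then
    (eBumpE2 Q).hi + max (FI.mul (eBumpC2 Q) (mulRat (FI.ofScaled (sqrtW Q).lo) 5 4)).hi
      (FI.mul (eBumpC2 Q) (mulRat (FI.ofScaled (sqrtW Q).hi) 5 4)).hi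
  else if q0 ≤ 9 * (SC : ℤ) then (eGlj Q).hi
  else if 4 * q0 ≤ 81 * (SC : ℤ) then (eWinDer (sqrtW Q).lo (sqrtW Q).hi).hi
  else 0

/-! ## §3. The integer checker inequality and the leaf check -/

/-- Scaled SIGNED gradient bound `A k = max |Σ_b min(derivLo·L, derivHi·L)| |Σ_b max(derivLo·L, derivHi·L)|` (interval sum, then absolute value). -/
def gradA2 (c0 : Fin 9 → ℤ) (k : Fin 9) : ℤ :=
  max |∑ b ∈ boxC, min (derivLo2 (q0z c0 b) * Lz b k) (derivHi2 (q0z c0 b) * Lz b k)|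
    |∑ b ∈ boxC, max (derivLo2 (q0z c0 b) * Lz b k) (derivHi2 (q0z c0 b) * Lz b k)|

/-- ★ **PER-TERM PART OF THE LEAF CHECK**: half-widths non-negative and, for every label, the three reflected term checks pass on the generated hints. -/
def termsOK2 (c0 w : Fin 9 → ℤ) : Bool :=
  decide (∀ k, 0 ≤ w k) &&
  decide (∀ b ∈ boxC,
    curvOK2 (q0z c0 b - rz w b) (q0z c0 b + rz w b) (curvM2 (q0z c0 b - rz w b) (q0z c0 b + rz w b)) = true ∧
    valLoOK2 (q0z c0 b) (valLo2 (q0z c0 b)) = true ∧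
    derivOK2 (q0z c0 b) (derivLo2 (q0z c0 b)) (derivHi2 (q0z c0 b)) = true)

/-- Aggregate 1 (scaled): `Σ_b valLo`. -/
def sumV2 (c0 : Fin 9 → ℤ) : ℤ := ∑ b ∈ boxC, valLo2 (q0z c0 b)

/-- Aggregate 2 (scaled, rounded UP): `Σₖ ⌈gradA k · wₖ / SC⌉`. -/
def sumG2 (c0 w : Fin 9 → ℤ) : ℤ := ∑ k, cdiv (gradA2 c0 k * w k) SC

/-- Aggregate 3 (scaled, rounded UP): `⌈Σ_b curvM_b · r_b² / (2·SC²)⌉`. -/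
def sumC2 (c0 w : Fin 9 → ℤ) : ℤ :=
  cdiv (∑ b ∈ boxC, curvM2 (q0z c0 b - rz w b) (q0z c0 b + rz w b) * rz w b ^ 2) (2 * (SC : ℤ) * SC)

/-! ## §4. Soundness -/

/-- ★★★ **SOUNDNESS OF THE LEAF CHECK.**  A shard supplies, per Gram leaf `(c0, w)` with target `μ`: the kernel fact `termsOK c0 w = true`, the three
kernel-evaluated aggregates `sumV c0 = s₁`, `sumG c0 w = s₂`, `sumC c0 w = s₃` (separate `decide +kernel` facts — measured ≈ 16 s / 39 s / 39 s per
3374-label leaf on the farm kernel, see the module's pilot note) and the literal comparison `μ ≤ s₁ − s₂ − s₃`; conclusion: the (P4) box floor of that leaf for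
every deformation whose Gram data lie in the box. [folklore] -/
theorem leaf_sound2 {c0 w : Fin 9 → ℤ} {μ s₁ s₂ s₃ : ℤ} (h : termsOK2 c0 w = true) (e₁ : sumV2 c0 = s₁) (e₂ : sumG2 c0 w = s₂) (e₃ : sumC2 c0 w = s₃)
    (hineq : μ ≤ s₁ - s₂ - s₃) (G : E3 →L[ℝ] E3)
    (hbox : ∀ k : Fin 9, |⟪G (fccVec ((@finProdFinEquiv 3 3).symm k).1), G (fccVec ((@finProdFinEquiv 3 3).symm k).2)⟫ - (c0 k : ℝ) / SC| ≤
      (w k : ℝ) / SC) :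
    (μ : ℝ) / SC ≤ ∑ b ∈ (Fintype.piFinset fun _ : Fin 3 => Finset.Icc (-7 : ℤ) 7).filter (fun b => b ≠ 0), effPot w₄₅ ω₄ (3 / 400) ‖latPt G fccVec b‖ := by
  subst e₁ e₂ e₃
  unfold termsOK2 at h
  rw [boxC_eq] at h
  simp only [Bool.and_eq_true, decide_eq_true_eq] at h
  obtain ⟨hw, hterms⟩ := h
  have hS := SC_pos
  have hS2 : (0:ℤ) < 2 * (SC : ℤ) * SC := mul_pos (mul_pos two_pos SCZ_pos) SCZ_pos
  refine boxSum_ge_of_termChecks2 c0 w (fun b => curvM2 (q0z c0 b - rz w b) (q0z c0 b + rz w b)) (fun b => valLo2 (q0z c0 b))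
    (fun b => derivLo2 (q0z c0 b)) (fun b => derivHi2 (q0z c0 b)) μ hw (fun b hb => (hterms b hb).1) (fun b hb => (hterms b hb).2.1)
    (fun b hb => (hterms b hb).2.2) ?_ G hbox
  -- the integer inequality, read in ℝ with outward rounding
  have hI : (μ : ℝ) ≤ ((∑ b ∈ box7, valLo2 (q0z c0 b) : ℤ) : ℝ) - ((∑ k, cdiv (gradA2 c0 k * w k) SC : ℤ) : ℝ) -
      ((cdiv (∑ b ∈ box7, curvM2 (q0z c0 b - rz w b) (q0z c0 b + rz w b) * rz w b ^ 2) (2 * (SC : ℤ) * SC) : ℤ) : ℝ) := by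
    unfold sumV2 sumG2 sumC2 at hineq; rw [boxC_eq] at hineq; exact_mod_cast hineq
  -- piece 2: Σ_k max |Σ_b min| |Σ_b max| · (w k/SC) ≤ (Σ_k cdiv (A_k w_k) SC)/SC
  have hL : ∀ (D : ℤ) (b : Fin 3 → ℤ) (k : Fin 9), ((D : ℝ) / SC) * (((b ((@finProdFinEquiv 3 3).symm k).1 : ℤ) : ℝ) * ((b ((@finProdFinEquiv 3 3).symm k).2 : ℤ) : ℝ)) = ((D * Lz b k : ℤ) : ℝ) / SC := by
    intro D b k; unfold Lz; push_cast; ring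
  have h2 : ∑ k, max (|∑ b ∈ box7, min (((derivLo2 (q0z c0 b) : ℝ) / SC) * (((b ((@finProdFinEquiv 3 3).symm k).1 : ℤ) : ℝ) * ((b ((@finProdFinEquiv 3 3).symm k).2 : ℤ) : ℝ))) (((derivHi2 (q0z c0 b) : ℝ) / SC) * (((b ((@finProdFinEquiv 3 3).symm k).1 : ℤ) : ℝ) * ((b ((@finProdFinEquiv 3 3).symm k).2 : ℤ) : ℝ)))|)
      (|∑ b ∈ box7, max (((derivLo2 (q0z c0 b) : ℝ) / SC) * (((b ((@finProdFinEquiv 3 3).symm k).1 : ℤ) : ℝ) * ((b ((@finProdFinEquiv 3 3).symm k).2 : ℤ) : ℝ))) (((derivHi2 (q0z c0 b) : ℝ) / SC) * (((b ((@finProdFinEquiv 3 3).symm k).1 : ℤ) : ℝ) * ((b ((@finProdFinEquiv 3 3).symm k).2 : ℤ) : ℝ)))|) * ((w k : ℝ) / SC) ≤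
      ((∑ k, cdiv (gradA2 c0 k * w k) SC : ℤ) : ℝ) / SC := by
    rw [Int.cast_sum, Finset.sum_div]
    refine Finset.sum_le_sum fun k _ => ?_
    have hA : max (|∑ b ∈ box7, min (((derivLo2 (q0z c0 b) : ℝ) / SC) * (((b ((@finProdFinEquiv 3 3).symm k).1 : ℤ) : ℝ) * ((b ((@finProdFinEquiv 3 3).symm k).2 : ℤ) : ℝ))) (((derivHi2 (q0z c0 b) : ℝ) / SC) * (((b ((@finProdFinEquiv 3 3).symm k).1 : ℤ) : ℝ) * ((b ((@finProdFinEquiv 3 3).symm k).2 : ℤ) : ℝ)))|)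
        (|∑ b ∈ box7, max (((derivLo2 (q0z c0 b) : ℝ) / SC) * (((b ((@finProdFinEquiv 3 3).symm k).1 : ℤ) : ℝ) * ((b ((@finProdFinEquiv 3 3).symm k).2 : ℤ) : ℝ))) (((derivHi2 (q0z c0 b) : ℝ) / SC) * (((b ((@finProdFinEquiv 3 3).symm k).1 : ℤ) : ℝ) * ((b ((@finProdFinEquiv 3 3).symm k).2 : ℤ) : ℝ)))|) =
        ((gradA2 c0 k : ℤ) : ℝ) / SC := by
      simp only [hL, min_div_div_right SC_pos.le, max_div_div_right SC_pos.le, ← Finset.sum_div, abs_div, abs_of_pos hS]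
      unfold gradA2; rw [boxC_eq]; push_cast; rfl
    rw [hA]
    have := div_le_cdiv (a := gradA2 c0 k * w k) (b := (SC : ℤ)) (by exact_mod_cast SCZ_pos)
    push_cast at this
    calc ((gradA2 c0 k : ℤ) : ℝ) / SC * ((w k : ℝ) / SC) = ((gradA2 c0 k : ℝ) * (w k) / SC) / SC := by field_simp
      _ ≤ ((cdiv (gradA2 c0 k * w k) SC : ℤ) : ℝ) / SC := div_le_div_of_nonneg_right this hS.le
  -- piece 3: ½ Σ (M/SC)(r/SC)² ≤ cdiv(Σ M r², 2 SC²)/SC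
  have h3 : 1 / 2 * ∑ b ∈ box7, ((curvM2 (q0z c0 b - rz w b) (q0z c0 b + rz w b) : ℝ) / SC) *
        (∑ k, |((b ((@finProdFinEquiv 3 3).symm k).1 : ℤ) : ℝ) * ((b ((@finProdFinEquiv 3 3).symm k).2 : ℤ) : ℝ)| * ((w k : ℝ) / SC)) ^ 2 ≤
      ((cdiv (∑ b ∈ box7, curvM2 (q0z c0 b - rz w b) (q0z c0 b + rz w b) * rz w b ^ 2) (2 * (SC : ℤ) * SC) : ℤ) : ℝ) / SC := by
    have hr : ∀ b : Fin 3 → ℤ, ∑ k, |((b ((@finProdFinEquiv 3 3).symm k).1 : ℤ) : ℝ) * ((b ((@finProdFinEquiv 3 3).symm k).2 : ℤ) : ℝ)| *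
        ((w k : ℝ) / SC) = ((rz w b : ℤ) : ℝ) / SC := by
      intro b; unfold rz Lz; push_cast; rw [Finset.sum_div]; exact Finset.sum_congr rfl fun k _ => by ring
    simp only [hr]
    have := div_le_cdiv (a := ∑ b ∈ box7, curvM2 (q0z c0 b - rz w b) (q0z c0 b + rz w b) * rz w b ^ 2) (b := 2 * (SC : ℤ) * SC) hS2
    have e : 1 / 2 * ∑ b ∈ box7, ((curvM2 (q0z c0 b - rz w b) (q0z c0 b + rz w b) : ℝ) / SC) * (((rz w b : ℤ) : ℝ) / SC) ^ 2 =
        (((∑ b ∈ box7, curvM2 (q0z c0 b - rz w b) (q0z c0 b + rz w b) * rz w b ^ 2 : ℤ) : ℝ) / ((2 * (SC : ℤ) * SC : ℤ) : ℝ)) / SC := by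
      push_cast
      rw [Finset.mul_sum, Finset.sum_div, Finset.sum_div]
      refine Finset.sum_congr rfl fun b _ => ?_
      field_simp
    rw [e]
    exact div_le_div_of_nonneg_right this hS.le
  -- piece 1 is an identity
  have h1 : ∑ b ∈ box7, ((valLo2 (q0z c0 b) : ℝ)) / SC = ((∑ b ∈ box7, valLo2 (q0z c0 b) : ℤ) : ℝ) / SC := by
    rw [Int.cast_sum, Finset.sum_div]
  have hI' := div_le_div_of_nonneg_right hI hS.le
  rw [sub_div, sub_div] at hI'
  simp only [box7] at h1 h2 h3 hI' ⊢
  linarith [h1, h2, h3, hI']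

/-! ## §5. Kernel smoke tests -/

/-- The hint generators pass their own checks on a first-shell term `q ∈ [0.9, 0.905]` and on a window term `q ∈ [12, 12.05]` (kernel). -/
example : curvOK2 (9 * (SC : ℤ) / 10) (905 * (SC : ℤ) / 1000) (curvM2 (9 * (SC : ℤ) / 10) (905 * (SC : ℤ) / 1000)) = true ∧
    curvOK2 (12 * (SC : ℤ)) (12 * (SC : ℤ) + (SC : ℤ) / 20) (curvM2 (12 * (SC : ℤ)) (12 * (SC : ℤ) + (SC : ℤ) / 20)) = true := by
  decide +kernel

/-- … and the value / derivative generators at `q₀ = 0.95`, `3`, `18` (beyond `16`!), `25`. -/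
example : (valLoOK2 (95 * (SC : ℤ) / 100) (valLo2 (95 * (SC : ℤ) / 100)) && derivOK2 (95 * (SC : ℤ) / 100) (derivLo2 (95 * (SC : ℤ) / 100))
      (derivHi2 (95 * (SC : ℤ) / 100)) && valLoOK2 (3 * (SC : ℤ)) (valLo2 (3 * (SC : ℤ))) && valLoOK2 (18 * (SC : ℤ)) (valLo2 (18 * (SC : ℤ))) &&
      derivOK2 (18 * (SC : ℤ)) (derivLo2 (18 * (SC : ℤ))) (derivHi2 (18 * (SC : ℤ))) && valLoOK2 (25 * (SC : ℤ)) (valLo2 (25 * (SC : ℤ)))) = true := by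
  decide +kernel

end Summit.AtomisticToContinuum.Crystallization.Theorems.FrustratedLawDichotomyStrainedPatchHomLeafCheckW
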